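import Literature.AnabelianGeometry.AbsoluteAnabelian.NeukirchUchidaTheorem
import Literature.AnabelianGeometry.AbsoluteAnabelian.NeukirchUchidaUniquenessProofs
import Literature.AnabelianGeometry.AbsoluteAnabelian.NeukirchUchidaTwoFieldsNaturalMap
import Literature.AnabelianGeometry.AbsoluteAnabelian.NumberFieldValuationProSetNeukirchProofs
import HarnessLib

/-!
# The Neukirch–Uchida theorem — unconditional forms of the cell's conditional consumers

With `neukirchUchida_holds F : NeukirchUchida F` (`NeukirchUchidaTheorem`, apex of the sub-DAG
`plan/L4/SUBDAG-NeukirchUchida.md`, abc-iut cell row G-L4d2g4-1) the tree's theorems that took the named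
fact `(h : NeukirchUchida F)` as a HYPOTHESIS become unconditional.  This file records them BY NAME
(one-line discharges, no new mathematics):

* `NeukirchUchida.existsUnique_ringEquiv_conj` / `…_top` — [AbsAnab] Thm 1.1.3 (one closure): for open
  `U₁, U₂ ≤ G_F` and `α : U₁ ⥲ U₂` there is EXACTLY ONE field automorphism `τ` of `F̄` inducing `α`
  (abc-iut-w4-d016's `NeukirchUchida.existsUnique`, `existsUnique_top`);
* `NeukirchUchida.exists_ne_top_map_stabilizer_eq` — (N2): `α(D_A ∩ U₁) = D_B ∩ U₂` for some finite
  place `B` (abc-iut-w5-d201's `NeukirchUchida.exists_map_stabilizer_eq`);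
* `NeukirchUchida.thm113₂_unconditional`, `thm113₂_bijective_unconditional`,
  `nonempty_ringEquiv_of_continuousMulEquiv` — [AbsAnab] Thm 1.1.3 for TWO number fields `F₁, F₂`
  (abc-iut-w6-d055's `thm113₂`, `thm113₂_bijective`, `nonempty_ringEquiv_of_continuousMulEquiv₂`);
* `NumberFieldValuationProSet.exists_equivariant_transport`, `…exists_decomp_map_eq` — the
  `α`-equivariant transport of the genuine `V⊚(F̄/F)` and (N1) (the cell's
  `exists_equivariant_transport_of_neukirchUchida`, `exists_decomp_map_eq_of_neukirchUchida`).

HONEST FRAMING: classical; outside the [IUTchIII] Cor. 3.12 cone; nothing here is an abc claim.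

## References
* [NeukirchSchmidtWingberg2008] Neukirch–Schmidt–Wingberg, *Cohomology of Number Fields*, Thm (12.2.1).
* [MochizukiAbsAnab2004] S. Mochizuki, *The absolute anabelian geometry of hyperbolic curves*, Thm 1.1.3.
-/

noncomputable section

open scoped Pointwise
open Field
open Literature.NumberTheory.GaloisRepresentations

namespace Literature.AnabelianGeometry.AbsoluteAnabelian

namespace NeukirchUchida

variable {F : Type} [Field F] [NumberField F]

/-- **[AbsAnab] Thm 1.1.3 (one closure), unconditional**: for open `U₁, U₂ ≤ G_F` and a topological
isomorphism `α : U₁ ⥲ U₂` there is EXACTLY ONE automorphism `τ` of the field `F̄` with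
`α(u) • τ x = τ (u • x)`. [cite: NeukirchSchmidtWingberg2008, Thm (12.2.1)]
[cite: MochizukiAbsAnab2004, Thm 1.1.3 p.6] -/
theorem existsUnique_ringEquiv_conj {U₁ U₂ : Subgroup (absoluteGaloisGroup F)}
    (hU₁ : IsOpen (U₁ : Set (absoluteGaloisGroup F))) (hU₂ : IsOpen (U₂ : Set (absoluteGaloisGroup F)))
    (α : U₁ ≃ₜ* U₂) :
    ∃! τ : AlgebraicClosure F ≃+* AlgebraicClosure F,
      ∀ (u : U₁) (x : AlgebraicClosure F),
        ((α u : U₂) : absoluteGaloisGroup F) • τ x = τ ((u : absoluteGaloisGroup F) • x) :=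
  existsUnique (neukirchUchida_holds F) hU₁ hU₂ α

/-- **(N0), bijective form, unconditional**: every topological automorphism `α` of `G_F` is conjugation
by EXACTLY ONE automorphism of the field `F̄`. [cite: NeukirchSchmidtWingberg2008, Thm (12.2.1)]
[cite: MochizukiAbsAnab2004, Thm 1.1.3 p.6] -/
theorem existsUnique_ringEquiv_conj_top (α : absoluteGaloisGroup F ≃ₜ* absoluteGaloisGroup F) :
    ∃! τ : AlgebraicClosure F ≃+* AlgebraicClosure F,
      ∀ (σ : absoluteGaloisGroup F) (x : AlgebraicClosure F), α σ • τ x = τ (σ • x) :=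
  existsUnique_top (neukirchUchida_holds F) α

/-- **(N2), unconditional**: a topological isomorphism `α : U₁ ⥲ U₂` between open subgroups of `G_F`
carries the decomposition group of every finite place `A` of `F̄` to that of a finite place `B`:
`α(D_A ∩ U₁) = D_B ∩ U₂`. [cite: NeukirchSchmidtWingberg2008, Thm (12.2.1)] -/
theorem exists_ne_top_map_stabilizer_eq {U₁ U₂ : Subgroup (absoluteGaloisGroup F)}
    (hU₁ : IsOpen (U₁ : Set (absoluteGaloisGroup F))) (hU₂ : IsOpen (U₂ : Set (absoluteGaloisGroup F)))
    (α : U₁ ≃ₜ* U₂) (A : ValuationSubring (AlgebraicClosure F)) (hA : A ≠ ⊤) :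
    ∃ B : ValuationSubring (AlgebraicClosure F), B ≠ ⊤ ∧
      ((MulAction.stabilizer (absoluteGaloisGroup F) A).subgroupOf U₁).map α.toMulEquiv.toMonoidHom =
        (MulAction.stabilizer (absoluteGaloisGroup F) B).subgroupOf U₂ :=
  Literature.NumberTheory.GaloisRepresentations.NeukirchUchida.exists_map_stabilizer_eq
    (neukirchUchida_holds F) hU₁ hU₂ α A hA

variable {F₁ F₂ : Type} [Field F₁] [NumberField F₁] [Field F₂] [NumberField F₂]

/-- **[AbsAnab] Thm 1.1.3 for two number fields, unconditional**: a topological isomorphism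
`α : G_{F₁} ⥲ G_{F₂}` is induced by EXACTLY ONE field isomorphism `τ : F̄₁ ⥲ F̄₂` carrying `F₁` onto `F₂`.
[cite: MochizukiAbsAnab2004, Thm 1.1.3 p.6] [cite: NeukirchSchmidtWingberg2008, Thm (12.2.1)] -/
theorem thm113₂_unconditional (α : absoluteGaloisGroup F₁ ≃ₜ* absoluteGaloisGroup F₂) :
    ∃! τ : AlgebraicClosure F₁ ≃+* AlgebraicClosure F₂,
      τ '' Set.range (algebraMap F₁ (AlgebraicClosure F₁)) = Set.range (algebraMap F₂ (AlgebraicClosure F₂)) ∧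
        ∀ (σ : absoluteGaloisGroup F₁) (x : AlgebraicClosure F₁), α σ • τ x = τ (σ • x) :=
  thm113₂ (neukirchUchida_holds ℚ) α

/-- **[AbsAnab] Thm 1.1.3, the literal bijection, unconditional**: «`τ` induces `α`» is the graph of a
bijection between `{τ : F̄₁ ⥲ F̄₂ | τ(F₁) = F₂}` and the topological isomorphisms `G_{F₁} ⥲ G_{F₂}`.
[cite: MochizukiAbsAnab2004, Thm 1.1.3 p.6] [cite: NeukirchSchmidtWingberg2008, Thm (12.2.1)] -/
theorem thm113₂_bijective_unconditional :
    (∀ τ : AlgebraicClosure F₁ ≃+* AlgebraicClosure F₂,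
        τ '' Set.range (algebraMap F₁ (AlgebraicClosure F₁)) = Set.range (algebraMap F₂ (AlgebraicClosure F₂)) →
          ∃! α : absoluteGaloisGroup F₁ ≃ₜ* absoluteGaloisGroup F₂,
            ∀ (σ : absoluteGaloisGroup F₁) (x : AlgebraicClosure F₁), α σ • τ x = τ (σ • x)) ∧
      ∀ α : absoluteGaloisGroup F₁ ≃ₜ* absoluteGaloisGroup F₂,
        ∃! τ : AlgebraicClosure F₁ ≃+* AlgebraicClosure F₂,
          τ '' Set.range (algebraMap F₁ (AlgebraicClosure F₁)) = Set.range (algebraMap F₂ (AlgebraicClosure F₂)) ∧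
            ∀ (σ : absoluteGaloisGroup F₁) (x : AlgebraicClosure F₁), α σ • τ x = τ (σ • x) :=
  thm113₂_bijective (neukirchUchida_holds ℚ)

/-- **Number fields with isomorphic absolute Galois groups are isomorphic**, unconditional.
[cite: NeukirchSchmidtWingberg2008, Thm (12.2.1)] [cite: MochizukiAbsAnab2004, Thm 1.1.3 p.6] -/
theorem nonempty_ringEquiv_of_continuousMulEquiv (α : absoluteGaloisGroup F₁ ≃ₜ* absoluteGaloisGroup F₂) :
    Nonempty (F₁ ≃+* F₂) :=
  nonempty_ringEquiv_of_continuousMulEquiv₂ (neukirchUchida_holds ℚ) α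

end NeukirchUchida

namespace NumberFieldValuationProSet

variable (F : Type) [Field F] [NumberField F]

/-- **`mapProVal` at the number-field model, unconditional**: for every continuous automorphism `α` of
`G_F` there is an `α`-equivariant self-homeomorphism of the genuine `V⊚(F̄/F)` fixing `⊚` and preserving
`V^non`, `V^arc` (the cell's `exists_equivariant_transport_of_neukirchUchida` with its hypothesis
discharged by `neukirchUchida_holds`). [cite: NeukirchSchmidtWingberg2008, (12.2.1)] -/
theorem exists_equivariant_transport (α : absoluteGaloisGroup F ≃ₜ* absoluteGaloisGroup F) :
    ∃ ψ : @Homeomorph (Carrier F) (Carrier F) (carrierTopology F) (carrierTopology F),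
      ψ (NumberField.valuationProSet F).generic = (NumberField.valuationProSet F).generic ∧
      ψ '' (NumberField.valuationProSet F).non = (NumberField.valuationProSet F).non ∧
      ψ '' (NumberField.valuationProSet F).arc = (NumberField.valuationProSet F).arc ∧
      ∀ (σ : absoluteGaloisGroup F) (v : Carrier F),
        (letI := carrierAction F; ψ (σ • v) = α σ • ψ v) :=
  exists_equivariant_transport_of_neukirchUchida F (neukirchUchida_holds F) α

/-- **(N1), unconditional**: every continuous automorphism of `G_F` permutes the decomposition groups of
the local elements of `V⊚(F̄/F)`. [cite: NeukirchSchmidtWingberg2008, (12.2.1)] -/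
theorem exists_decomp_map_eq (α : absoluteGaloisGroup F ≃ₜ* absoluteGaloisGroup F) (v : Carrier F) :
    ∃ v' : Carrier F, ((NumberField.valuationProSet F).decomp v).map α.toMulEquiv.toMonoidHom =
      (NumberField.valuationProSet F).decomp v' :=
  exists_decomp_map_eq_of_neukirchUchida F (neukirchUchida_holds F) α v

end NumberFieldValuationProSet

end Literature.AnabelianGeometry.AbsoluteAnabelian

end
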